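import Mathlib.RingTheory.Derivation.Basic
import Mathlib.RingTheory.Ideal.Over
import HarnessLib

/-!
# Derivations over a base `R` into modules killed by an ideal `J ⊆ R` factor through the closed fibre `A ⧸ J·A`

Layer `Literature/RingTheory/Derivation`, namespace `Literature.RingTheory.Derivation`.  THEOREMS ONLY (no definition,
no named fact, no instance).  Generic commutative algebra, Mathlib-only imports.

For a commutative ring `R`, an ideal `J ⊆ R` (`R₀ := R ⧸ J` the «closed subscheme of the base»), an `R`-algebra `A`
(`A₀ := A ⧸ J·A` the closed fibre) and an `A`-module `N` on which `J` acts by zero (equivalently: `N` is an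
`A₀`-module), every `R`-derivation `D : A → N` VANISHES ON `J·A` and FACTORS UNIQUELY through `A₀` as an
`R₀`-derivation `D̄ : A₀ → N`, `D̄(ā) = D(a)`; conversely every `R₀`-derivation of `A₀` restricts to an `R`-derivation of
`A`.  In sheaf language: for a morphism `X → S` and a closed subscheme `S₀ ↪ S` with ideal `𝒥_S`, and an
`𝒪_{X₀}`-module `𝒥` (`X₀ = X ×_S S₀`), `𝓗om_{𝒪_X}(Ω¹_{X/S}, 𝒥) = 𝓗om_{𝒪_{X₀}}(Ω¹_{X₀/S₀}, 𝒥)` — the remark behind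
[SGA1, Exp. III §5 Prop. 5.1], where the group of the lift-torsor `𝒢 = 𝓗om_{𝒪_{Y₀}}(g₀^*Ω¹_{X/S}, 𝒥)` is read on the closed
fibre (Ω¹ commutes with base change, [SGA1, Exp. II Cor. 4.4 / Prop. 4.3]).

* `apply_eq_zero_of_mem_map` — `D` kills `J·A = J.map (algebraMap R A)` as soon as `J • N = 0`;
* `apply_eq_of_sub_mem_map` — hence `D a` only depends on `a mod J·A`;
* **`existsUnique_quotient_derivation`** — there is a UNIQUE `R ⧸ J`-derivation `D̄` of `A ⧸ J·A` into `N` with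
  `D̄ ∘ mk = D` (for the Mathlib algebra structure `Ideal.Quotient.algebraQuotientMapQuotient`);
* `exists_derivation_comp_mk` — conversely an `R ⧸ J`-derivation of `A ⧸ J·A` composed with `mk` is an `R`-derivation
  of `A` (the values agree pointwise);
so `Der_R(A, N) ≃ Der_{R/J}(A/J·A, N)` by `D ↦ D̄`, stated as the two `∃`/`∃!` theorems (no `def`).

Cell hodgecm-mathlib (D-0151), SOCKETS-F §4 (α) node E3 (closed-fibre reduction of the DEF-MOR torsor group: with
`S = Spec k[ε]`, `J = (ε)`, `ε·𝒥 = 0` the torsor group `Der_{k[ε]}(Γ(X, V), 𝒥)` of ★ `Deformation/MorphismLiftsSquareZeroAffine`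
is `Der_k(Γ(X₀, V₀), 𝒥)`, the framed `T_{X₀} ⊗ 𝒥` of [MumfordFogartyKirwan1994, Prop. 6.15]); count-neutral generic
capital.  HC_CM is proved only modulo the 7 printed citations until rung 0 closes; this file discharges none of them.

## References
* [SGA1] A. Grothendieck, M. Raynaud, *Revêtements étales et groupe fondamental (SGA 1)*, LNM 224 / arXiv:math/0206203:
  Exp. III §5 Prop. 5.1 (arXiv ed. p. 71, held `paper:arxiv-math_0206203` p0049); Exp. II Prop. 4.3 / Cor. 4.4
  (behaviour of `Ω¹` under base change).
* [MumfordFogartyKirwan1994] *Geometric Invariant Theory*, 3rd ed., Ch. 6 §3 Prop. 6.15 (pp. 130–131): consumer.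
-/

namespace Literature.RingTheory.Derivation

variable {R A N : Type*} [CommRing R] [CommRing A] [Algebra R A] [AddCommGroup N] [Module A N] [Module R N]
  [IsScalarTower R A N] (J : Ideal R)

/-! ### §1 An `R`-derivation into a module killed by `J` vanishes on `J·A` -/

/-- **`D` kills `J·A`**: if `J • N = 0` then every `R`-derivation `D : A → N` vanishes on the extended ideal
`J·A = J.map (algebraMap R A)` (`D(x · j) = x·D(j) + j·D(x) = 0 + 0`). [cite: SGA1, Exp. III §5 Prop. 5.1] -/
theorem apply_eq_zero_of_mem_map (D : _root_.Derivation R A N) (hJ : ∀ j ∈ J, ∀ n : N, j • n = 0) {a : A}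
    (ha : a ∈ J.map (algebraMap R A)) : D a = 0 := by
  -- the predicate «`D (x * a) = 0` for all `x`» is stable under the ideal operations and holds on the generators
  suffices h : ∀ x : A, D (x * a) = 0 by simpa using h 1
  rw [Ideal.map, ← Ideal.submodule_span_eq] at ha
  refine Submodule.span_induction (p := fun a _ => ∀ x : A, D (x * a) = 0) ?_ ?_ ?_ ?_ ha
  · rintro _ ⟨j, hj, rfl⟩ x
    rw [D.leibniz, D.map_algebraMap, smul_zero, zero_add, algebraMap_smul]
    exact hJ j hj _
  · intro x; rw [mul_zero, D.map_zero]
  · intro a b _ _ ha hb x; rw [mul_add, D.map_add, ha, hb, add_zero]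
  · intro c a _ ha x; rw [smul_eq_mul, ← mul_assoc]; exact ha (x * c)

/-- Hence `D a` depends only on `a` modulo `J·A`. [cite: SGA1, Exp. III §5 Prop. 5.1] -/
theorem apply_eq_of_sub_mem_map (D : _root_.Derivation R A N) (hJ : ∀ j ∈ J, ∀ n : N, j • n = 0) {a b : A}
    (h : a - b ∈ J.map (algebraMap R A)) : D a = D b :=
  sub_eq_zero.mp (by rw [← D.map_sub]; exact apply_eq_zero_of_mem_map J D hJ h)

/-- When `N` is a module over `R ⧸ J` compatibly with `R`, the ideal `J` acts by zero on `N`.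
[cite: SGA1, Exp. III §5 Prop. 5.1] -/
theorem smul_eq_zero_of_mem [Module (R ⧸ J) N] [IsScalarTower R (R ⧸ J) N] {j : R} (hj : j ∈ J) (n : N) :
    j • n = 0 := by
  rw [← algebraMap_smul (R ⧸ J) j n, Ideal.Quotient.algebraMap_eq, Ideal.Quotient.eq_zero_iff_mem.mpr hj, zero_smul]

/-! ### §2 The factorisation through the closed fibre `A ⧸ J·A` -/

section Factor

variable [Module (R ⧸ J) N] [IsScalarTower R (R ⧸ J) N]
  [Module (A ⧸ J.map (algebraMap R A)) N] [IsScalarTower A (A ⧸ J.map (algebraMap R A)) N]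
  [IsScalarTower (R ⧸ J) (A ⧸ J.map (algebraMap R A)) N]

omit [Module A N] [Module R N] [IsScalarTower R A N] [IsScalarTower R (R ⧸ J) N]
  [IsScalarTower A (A ⧸ J.map (algebraMap R A)) N] [IsScalarTower (R ⧸ J) (A ⧸ J.map (algebraMap R A)) N] in
/-- Uniqueness: two `R ⧸ J`-derivations of `A ⧸ J·A` agreeing on the image of `A` are equal (`mk` is surjective).
[cite: SGA1, Exp. III §5 Prop. 5.1] -/
theorem quotient_derivation_ext {E E' : _root_.Derivation (R ⧸ J) (A ⧸ J.map (algebraMap R A)) N}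
    (h : ∀ a : A, E (Ideal.Quotient.mk _ a) = E' (Ideal.Quotient.mk _ a)) : E = E' := by
  ext x
  obtain ⟨a, rfl⟩ := Ideal.Quotient.mk_surjective x
  exact h a

omit [IsScalarTower (R ⧸ J) (A ⧸ J.map (algebraMap R A)) N] in
/-- **Every `R`-derivation of `A` into an `(A ⧸ J·A)`-module factors UNIQUELY through `A ⧸ J·A` as an
`R ⧸ J`-derivation**: `∃! D̄, D̄ (ā) = D a`.  (`D` is constant on cosets by `apply_eq_of_sub_mem_map`; additivity,
`R ⧸ J`-linearity and the Leibniz rule are checked on representatives.) [cite: SGA1, Exp. III §5 Prop. 5.1] -/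
theorem existsUnique_quotient_derivation (D : _root_.Derivation R A N) :
    ∃! E : _root_.Derivation (R ⧸ J) (A ⧸ J.map (algebraMap R A)) N, ∀ a : A, E (Ideal.Quotient.mk _ a) = D a := by
  classical
  have hJ : ∀ j ∈ J, ∀ n : N, j • n = 0 := fun j hj n => smul_eq_zero_of_mem J hj n
  -- the underlying function, by choosing representatives
  let f : A ⧸ J.map (algebraMap R A) → N := fun x => D (Quotient.out x)
  have hf : ∀ a : A, f (Ideal.Quotient.mk _ a) = D a := fun a =>
    apply_eq_of_sub_mem_map J D hJ (Ideal.Quotient.eq.mp (Ideal.Quotient.mk_out _))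
  have hf' : ∀ x, ∃ a, x = Ideal.Quotient.mk _ a ∧ f x = D a := fun x => by
    obtain ⟨a, rfl⟩ := Ideal.Quotient.mk_surjective x; exact ⟨a, rfl, hf a⟩
  let L : (A ⧸ J.map (algebraMap R A)) →ₗ[R ⧸ J] N :=
    { toFun := f
      map_add' := fun x y => by
        obtain ⟨a, rfl⟩ := Ideal.Quotient.mk_surjective x
        obtain ⟨b, rfl⟩ := Ideal.Quotient.mk_surjective y
        rw [← map_add, hf, hf, hf, D.map_add]
      map_smul' := fun c x => by
        obtain ⟨r, rfl⟩ := Ideal.Quotient.mk_surjective c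
        obtain ⟨a, rfl⟩ := Ideal.Quotient.mk_surjective x
        rw [RingHom.id_apply, Ideal.Quotient.mk_smul_mk_quotient_map_quotient, hf, hf, D.leibniz, D.map_algebraMap,
          smul_zero, add_zero, algebraMap_smul, ← Ideal.Quotient.algebraMap_eq, algebraMap_smul] }
  refine ⟨{ toLinearMap := L
            map_one_eq_zero' := ?_
            leibniz' := ?_ }, fun a => hf a, fun E hE => quotient_derivation_ext J fun a => ?_⟩
  · change f 1 = 0
    rw [← (Ideal.Quotient.mk _).map_one, hf, D.map_one_eq_zero]
  · intro x y
    obtain ⟨a, rfl⟩ := Ideal.Quotient.mk_surjective x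
    obtain ⟨b, rfl⟩ := Ideal.Quotient.mk_surjective y
    change f (Ideal.Quotient.mk _ a * Ideal.Quotient.mk _ b) =
      Ideal.Quotient.mk _ a • f (Ideal.Quotient.mk _ b) + Ideal.Quotient.mk _ b • f (Ideal.Quotient.mk _ a)
    rw [← map_mul, hf, hf, hf, D.leibniz, ← Ideal.Quotient.algebraMap_eq, algebraMap_smul, algebraMap_smul]
  · rw [hE a]; exact (hf a).symm

omit [IsScalarTower R A N] in
/-- **Conversely**, an `R ⧸ J`-derivation `E` of the closed fibre gives the `R`-derivation `E ∘ mk` of `A`: there is an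
`R`-derivation `D` of `A` with `D a = E ā` for all `a`. [cite: SGA1, Exp. III §5 Prop. 5.1] -/
theorem exists_derivation_comp_mk (E : _root_.Derivation (R ⧸ J) (A ⧸ J.map (algebraMap R A)) N) :
    ∃ D : _root_.Derivation R A N, ∀ a : A, D a = E (Ideal.Quotient.mk _ a) := by
  let L : A →ₗ[R] N :=
    { toFun := fun a => E (Ideal.Quotient.mk _ a)
      map_add' := fun a b => by rw [map_add, E.map_add]
      map_smul' := fun r a => by
        rw [RingHom.id_apply, Algebra.smul_def, map_mul, ← Ideal.Quotient.algebraMap_quotient_map_quotient,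
          E.leibniz, E.map_algebraMap, smul_zero, add_zero, algebraMap_smul, ← Ideal.Quotient.algebraMap_eq,
          algebraMap_smul] }
  refine ⟨{ toLinearMap := L
            map_one_eq_zero' := ?_
            leibniz' := fun a b => ?_ }, fun a => rfl⟩
  · change E (Ideal.Quotient.mk _ 1) = 0
    rw [map_one, E.map_one_eq_zero]
  · change E (Ideal.Quotient.mk _ (a * b)) = a • E (Ideal.Quotient.mk _ b) + b • E (Ideal.Quotient.mk _ a)
    rw [map_mul, E.leibniz, ← Ideal.Quotient.algebraMap_eq, algebraMap_smul, algebraMap_smul]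

omit [IsScalarTower R A N] [IsScalarTower R (R ⧸ J) N] [IsScalarTower A (A ⧸ J.map (algebraMap R A)) N]
  [IsScalarTower (R ⧸ J) (A ⧸ J.map (algebraMap R A)) N] in
/-- The two constructions are inverse on the nose at the level of values: the factorisation `D̄` of `E ∘ mk` is `E`
(by uniqueness). [cite: SGA1, Exp. III §5 Prop. 5.1] -/
theorem quotient_derivation_of_comp_mk (E E' : _root_.Derivation (R ⧸ J) (A ⧸ J.map (algebraMap R A)) N)
    (D : _root_.Derivation R A N) (hD : ∀ a : A, D a = E (Ideal.Quotient.mk _ a))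
    (hE' : ∀ a : A, E' (Ideal.Quotient.mk _ a) = D a) : E' = E :=
  quotient_derivation_ext J fun a => by rw [hE' a, hD a]

end Factor

end Literature.RingTheory.Derivation
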